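import Summits.BirchSwinnertonDyer.BirchSwinnertonDyer.Theses.LeadingTerm
import Summits.BirchSwinnertonDyer.BirchSwinnertonDyer.Theorems.LeadingTermTamePinchRStubAdmissibleSupply
import Summits.BirchSwinnertonDyer.BirchSwinnertonDyer.Theorems.LeadingTermTamePinchRStubShaTorsionCofinite
import Summits.BirchSwinnertonDyer.BirchSwinnertonDyer.Theorems.LeadingTermTamePinchRStubLocalTorsionTrivial
import Summits.BirchSwinnertonDyer.BirchSwinnertonDyer.Theorems.LeadingTermTamePinchRStubManinPeriodCofinite
import Literature.NumberTheory.EllipticCurves.KuriharaNumberKimCertificate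
import Literature.NumberTheory.EllipticCurves.ModularCurveRealPeriodProofs
import Literature.NumberTheory.EllipticCurves.TamagawaFiniteIndexProofs
import Literature.NumberTheory.EllipticCurves.ModularParametrizationTrustBaseProofs
import Literature.NumberTheory.EllipticCurves.ModularParametrizationDegreeHoldsProofs
import Literature.NumberTheory.EllipticCurves.BSDSha
import Literature.NumberTheory.EllipticCurves.LeadingTerm
import HarnessLib

/-!
# BirchSwinnertonDyer / LeadingTerm — crux `TamePinchR` (stmt-BirchSwinnertonDyer-17007), line `Sketch`:
# the tame pinch from modularity, Kim's structure theorem and finiteness of Ш (conditional composition)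

Crux (support, conjecture-grade, rev 6): every NON-CM elliptic `E/ℚ` (globally minimal `W`) has an
admissible prime `p` (good ordinary, `p ≥ 5`, `ρ̄_{E,p}` onto), a newform `f` of `W` and a
square-free product `n` of `r = rank_ℤ E(ℚ)` Kolyvagin primes whose mod-`p` Kurihara number
`δ_n = ∑_{a ∈ (ℤ/n)ˣ} [a/n]⁺_f ∏_ℓ ψ_ℓ(a)` is non-zero for some surjective discrete logarithms `ψ_ℓ`.

This file proves the crux CONDITIONALLY on three named hypotheses and nothing else:

* `exists_isNewformOf` (tree named fact, the Modularity Theorem, BCDT 2001 Thm. A — it IS the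
  `∃ f, IsNewformOf W f` that the crux itself asserts, so no unconditional proof can avoid it; the
  modular parametrisation datum with its Manin constant then comes from the tree theorems
  `nonempty_modularParametrizationData_of_exists_isNewformOf` and
  `IsNewformOf.exists_maninConstant_ne_zero_holds`, Shimura + Faltings);
* `Kim2022_kuriharaNumber_certificate` (Literature named fact, file `KuriharaNumberKimCertificate`:
  C.-H. Kim arXiv:2203.12159 Thm. 1.11 with Cor. 1.6 — at an admissible `p` with Kim's side
  conditions and `Ш(E)[p] = 0` there is `n ∈ 𝒩₁` with `ν(n) = rank` and `δ_n ≢ 0 (mod p)`);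
* `ShaFiniteConjecture` (Tate 1974 Conj. 1, the tree's registered open conjecture, `BSDSha`).

Everything else is a theorem of the tree, landed as the four stubs of the registered skeleton
(`Cruxes/TamePinchR/Lines/Sketch.lean`): `stub_admissibleSupply` (Serre open image + Chebotarev in
`ℚ(E[3])`: cofinally many good ordinary non-anomalous `p` with surjective `ρ̄_{E,p}`),
`stub_shaTorsionCofinite` (finite `Ш` ⇒ `Ш[p] = 0` for almost all `p`), `stub_localTorsionTrivial`
(`a_p ≢ 1 ⇒ E(ℚ_p)[p] = 0`, Silverman AEC VII.3.1), `stub_maninPeriodCofinite` (Manin constant and the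
period ratio `Ω(W)/Ω⁺_f` are `p`-adic units for almost all `p`, Edixhoven 1991 §1); the Tamagawa side
condition is `tamagawaProduct_pos'`. So, granting modularity and Kim's theorem (theorems in print),
`TamePinchR` is reduced to — and at each admissible prime is equivalent to — the vanishing of
`Ш(E/ℚ)[p]` at ONE admissible prime per non-CM curve, which finiteness of `Ш` supplies.
-/

set_option linter.dupNamespace false

noncomputable section

namespace Summit.BirchSwinnertonDyer.BirchSwinnertonDyer.Theorems

open scoped MatrixGroups ModularForm Classical
open CongruenceSubgroup Literature.NumberTheory.EllipticCurves
  Literature.NumberTheory.EllipticCurves.ModularForms WeierstrassCurve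
open Summit.BirchSwinnertonDyer.BirchSwinnertonDyer.Theses.LeadingTerm (TamePinchR)

/-- **`TamePinchR` from modularity, Kim's certificate and finiteness of `Ш`.** For a non-CM
elliptic `W`: take a modular parametrisation datum `D` at level `N_W` (from `hMod` by
`nonempty_modularParametrizationData_of_exists_isNewformOf` and
`IsNewformOf.exists_maninConstant_ne_zero_holds`; `N_W ≠ 0` by `conductorNorm_pos_holds`), the finite exceptional sets of `stub_shaTorsionCofinite` (fed by `hSha`)
and `stub_maninPeriodCofinite`, and the prime divisors of the Tamagawa product
(`tamagawaProduct_pos'`); `stub_admissibleSupply` gives an admissible non-anomalous prime `p`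
outside them; `stub_localTorsionTrivial` gives `E(ℚ_p)[p] = 0`; Kim's certificate (`hKim`) then
yields `n`, `ψ` with `kuriharaNumber D.f p n ψ ≠ 0`, which is the crux's inlined sum
(`kuriharaNumber_eq_sum_ratCast`). CONDITIONAL on the three hypotheses (two theorems in print and the
finiteness of `Ш`); it does not close the item. [cite: Kim2022StructureSelmer, Thm. 1.11 and Cor. 1.6 (PDF pp. 6–8)] -/
theorem tamePinchR_of_facts : Literature.NumberTheory.EllipticCurves.ModularForms.exists_isNewformOf → Literature.NumberTheory.EllipticCurves.Kim2022_kuriharaNumber_certificate → Literature.NumberTheory.EllipticCurves.ShaFiniteConjecture → Summit.BirchSwinnertonDyer.BirchSwinnertonDyer.Theses.LeadingTerm.TamePinchR := by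
  intro hMod hKim hSha W _ _ hCM
  haveI : NeZero (W.conductorNorm ℤ) := ⟨(W.conductorNorm_pos_holds).ne'⟩
  obtain ⟨D⟩ := nonempty_modularParametrizationData_of_exists_isNewformOf hMod
    IsNewformOf.exists_maninConstant_ne_zero_holds W
  obtain ⟨S₁, hS₁⟩ := stub_shaTorsionCofinite W (hSha W inferInstance)
  obtain ⟨S₂, hS₂⟩ := stub_maninPeriodCofinite W D
  obtain ⟨p, hpS, hp, h5, hord, hsurj, hna⟩ :=
    stub_admissibleSupply W hCM (S₁ ∪ S₂ ∪ W.tamagawaProduct.primeFactors)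
  simp only [Finset.mem_union, not_or] at hpS
  obtain ⟨⟨hp₁, hp₂⟩, hp₃⟩ := hpS
  have hsha := hS₁ p hp₁ hp.out
  obtain ⟨hc, hu⟩ := hS₂ p hp₂ hp
  have htam : ¬ p ∣ W.tamagawaProduct := fun h ↦
    hp₃ (Nat.mem_primeFactors.mpr ⟨hp.out, h, (W.tamagawaProduct_pos').ne'⟩)
  have htors := stub_localTorsionTrivial W p h5 hord.1 hna
  obtain ⟨n, hn, hsq, hcard, hkoly, ψ, hψ, hδ⟩ := hKim W p h5 hord hsurj htors htam hsha D hc hu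
  refine ⟨p, hp, h5, hord, hsurj, W.conductorNorm ℤ, inferInstance, D.f, D.isNewformOf, n, hn, hsq,
    hcard, hkoly, ψ, hψ, ?_⟩
  rwa [kuriharaNumber_eq_sum_ratCast] at hδ

/-- **`TamePinchR` from modularity, Kim's certificate and the COFINITE vanishing of `Ш[p]`.**
The same composition with the finiteness of `Ш` replaced by the weaker per-curve input it actually
consumes: for every NON-CM globally minimal elliptic `W/ℚ`, `Ш(W/ℚ)[p] = 0` for all primes `p`
outside some finite set (⇐ `Ш(W)` finite, `stub_shaTorsionCofinite`; by Kim's sandwich this is,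
granting the two theorems in print, essentially the open content of the crux). CONDITIONAL; it does
not close the item. [cite: Kim2022StructureSelmer, Thm. 1.11 and Cor. 1.6 (PDF pp. 6–8)] -/
theorem tamePinchR_of_shaTorsionCofinite : Literature.NumberTheory.EllipticCurves.ModularForms.exists_isNewformOf → Literature.NumberTheory.EllipticCurves.Kim2022_kuriharaNumber_certificate → (∀ (W : WeierstrassCurve ℚ) [W.IsElliptic] [W.IsGloballyMinimal], ¬ W.HasCM → ∃ S : Finset ℕ, ∀ p ∉ S, p.Prime → ∀ x : W.sha, (p : ℤ) • x = 0 → x = 0) → Summit.BirchSwinnertonDyer.BirchSwinnertonDyer.Theses.LeadingTerm.TamePinchR := by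
  intro hMod hKim hShaCof W _ _ hCM
  haveI : NeZero (W.conductorNorm ℤ) := ⟨(W.conductorNorm_pos_holds).ne'⟩
  obtain ⟨D⟩ := nonempty_modularParametrizationData_of_exists_isNewformOf hMod
    IsNewformOf.exists_maninConstant_ne_zero_holds W
  obtain ⟨S₁, hS₁⟩ := hShaCof W hCM
  obtain ⟨S₂, hS₂⟩ := stub_maninPeriodCofinite W D
  obtain ⟨p, hpS, hp, h5, hord, hsurj, hna⟩ :=
    stub_admissibleSupply W hCM (S₁ ∪ S₂ ∪ W.tamagawaProduct.primeFactors)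
  simp only [Finset.mem_union, not_or] at hpS
  obtain ⟨⟨hp₁, hp₂⟩, hp₃⟩ := hpS
  have hsha := hS₁ p hp₁ hp.out
  obtain ⟨hc, hu⟩ := hS₂ p hp₂ hp
  have htam : ¬ p ∣ W.tamagawaProduct := fun h ↦
    hp₃ (Nat.mem_primeFactors.mpr ⟨hp.out, h, (W.tamagawaProduct_pos').ne'⟩)
  have htors := stub_localTorsionTrivial W p h5 hord.1 hna
  obtain ⟨n, hn, hsq, hcard, hkoly, ψ, hψ, hδ⟩ := hKim W p h5 hord hsurj htors htam hsha D hc hu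
  refine ⟨p, hp, h5, hord, hsurj, W.conductorNorm ℤ, inferInstance, D.f, D.isNewformOf, n, hn, hsq,
    hcard, hkoly, ψ, hψ, ?_⟩
  rwa [kuriharaNumber_eq_sum_ratCast] at hδ

/-- **The open residue sits in analytic rank `≥ 2`.** Granting modularity, Kim's certificate and
the Gross–Zagier–Kolyvagin theorem in the tree's form `rank_eq_analyticRank_of_analyticRank_le_one`
(`r_an ≤ 1 ⇒ rank = r_an ∧ Ш finite`; Gross–Zagier 1986, Kolyvagin 1990, with modularity), the crux
`TamePinchR` follows from the cofinite vanishing of `Ш(W)[p]` for the non-CM curves of ANALYTIC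
RANK `≥ 2` only: in analytic rank `≤ 1` the finiteness of `Ш` feeds `stub_shaTorsionCofinite`.
CONDITIONAL; it does not close the item. [cite: Kolyvagin1990, Thm. A] -/
theorem tamePinchR_of_gzk_of_shaTorsionCofinite_two_le : Literature.NumberTheory.EllipticCurves.ModularForms.exists_isNewformOf → Literature.NumberTheory.EllipticCurves.Kim2022_kuriharaNumber_certificate → Literature.NumberTheory.EllipticCurves.rank_eq_analyticRank_of_analyticRank_le_one → (∀ (W : WeierstrassCurve ℚ) [W.IsElliptic] [W.IsGloballyMinimal], ¬ W.HasCM → 2 ≤ W.analyticRank → ∃ S : Finset ℕ, ∀ p ∉ S, p.Prime → ∀ x : W.sha, (p : ℤ) • x = 0 → x = 0) → Summit.BirchSwinnertonDyer.BirchSwinnertonDyer.Theses.LeadingTerm.TamePinchR := by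
  intro hMod hKim hGZK hTwo
  refine tamePinchR_of_shaTorsionCofinite hMod hKim fun W _ _ hCM ↦ ?_
  by_cases h : W.analyticRank ≤ 1
  · exact stub_shaTorsionCofinite W (hGZK W h).2
  · exact hTwo W hCM (by omega)

end Summit.BirchSwinnertonDyer.BirchSwinnertonDyer.Theorems

end
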